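import Summits.BirchSwinnertonDyer.Rank1Residual.Partition.X10CongruenceTransfer
import Summits.BirchSwinnertonDyer.Rank1Residual.Partition.X10DescentRowC16
import HarnessLib

/-!
# Row C16 / D3 at `p = 3`: congruence transfer from a partner closed by the EXPLICIT `3`-DESCENT lever
# (road G with a road-D partner) — the door for the last flag-only literal class of row D3, `384400cx1`
# (cell `bsd-litref`, paper sub-dir `yz26`, seat `bsd-litref-yz26-pv` g5; LADDER-BSD H0/H1 · W7)

HONEST FRAMING (programme `BSD-LIT2PART-PROGRAMME-v1.md` §HONESTY, verbatim): «no tranche here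
proves BSD; ARM L moves the LITERAL column of an r ≤ 1 census into the
kernel-proved-modulo-named-print column; ARM P changes what «named print» is worth.» Theorems only:
no definition, no new named fact, nothing asserted about Yan–Zhu's theorem; every published theorem
enters BY NAME as one of the tree's existing named facts, taken as a hypothesis. Nothing here moves a
class: the per-pair CERTIFICATES (the partner's `3`-descent element, its exact `#Ш_an`, the torsion
isomorphism C1, the `μ`-coefficient C2) are explicit binders, produced by the lane's engines and
priced by the referee.

## Why

After referee A's rounds R538 / R622 / R659 (2026-08-27) row D3 (= row C16 at `p = 3`, 5 437 register
classes) keeps ONE flag-only literal class: `384400cx1` (`r_an = 0`, `#Ш_an = 81`, `dim_𝔽₃ Sel^(3) = 2`,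
so `Ш[3] ≅ (ℤ/3)²` and BSD₃ asks for an element of order `9` in `Ш` — out of reach of the Cassels–Tate
lever `Typed.bsdp_of_wuthrich_of_casselsTate_of_dvd`, which needs `ord₃ #Ш_an ≤ 2`). Its mod-`3`
CONGRUENT PARTNER `384400ct1` (same conductor `2⁴·5²·31²`, `r_an = 0`, `#E(ℚ)_tors = 1`, `∏ c_ℓ = 2`,
`#Ш_an = 9`) was closed in R538 by road (D): an explicit `3`-descent exhibits `3 ∣ #Sel^(3)`, hence
`Ш[3] ≠ 0`, and Cassels–Tate + Wuthrich 2014 Prop. 21 give `BSD(ct1, 3)`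
(`RowC16.bsdp_three_rankZero_of_selmer_certificate`, `X10DescentRowC16.lean`, p503951). The cell memo
`pub/bsd-litref/yz26/D3-DOOR-CENSUS.md` §2 (seat g2) recorded «43 [rank-0 targets have] a partner with
`#Ш_an(E₁) = 9·unit`, usable once THAT partner is closed by CT» — this file is that use: the partner's
`BSD(E₁,3)` binder of the congruence-transfer door `RowC16.bsdp_three_rankZero_of_congruentPartner`
(`X10CongruenceTransfer.lean`, p476288) is discharged BY NAME by the road-(D) door, so that the whole
chain is ONE theorem whose hypotheses are named facts + per-pair certificates + register rows.

## The chain (all inputs PUBLISHED and already typed; `p = 3` inside every printed range)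

Partner `E₁` on row C16 with `r_an(E₁) = 0`, `ord₃ #Ш_an(E₁) ≤ 2` and a `3`-descent certificate
`3 ∣ #Sel^(3)(E₁/ℚ)` ⟹ [Cassels–Tate (`exists_casselsTate_pairing`, Silverman X.4.14) + Wuthrich 2014
Prop. 21 (`sha_dvd_analyticSha`) + GZK + modularity] `BSD(E₁,3)` ⟹ [Kato 2004 Thm. 17.4 (3)
(`kato_divisibility`) + Wuthrich 2014 Lemma 20 (tree THEOREM
`lemma20_surjective_threeAdic_of_semistable_holds`, discharged here) + Greenberg LNM 1716 Thm. 4.1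
(`greenberg_charValue_rankZero`) + Mazur 1978 Cor. 4.1 (`mazur_not_dvd_maninConstant_of_odd`)]
Mazur's main conjecture for `(E₁, 3)` ⟹ [+ C2 `μ(E₁) = 0`: one `3`-adic unit coefficient of
`ϖ₁ · L₃(f₁, α₁)`, on `E₁` itself or — Emerton–Pollack–Weston 2006 Thm. 1
(`thm1_muAn_transfer_of_torsionIso_odd`) — on any witness of the congruence class] ⟹ [Greenberg–
Vatsal 2000 Thm. (1.4) (`thm14_mainConjecture_transfer_of_torsionIso`) along C1 `E₁[3] ≅ E₂[3]`]
Mazur's main conjecture for `(E₂, 3)` ⟹ [`RowC16.bsdp_rankZero_of_mazurMainConjecture`: Greenberg 4.1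
+ modularity + GZK] `BSD(E₂,3)` for the rank-`0` TARGET `E₂` — with NO hypothesis on `#Ш(E₂)`.

## What is NOT claimed

No class is closed by this file; no partner search is formalised (the congruence `a_ℓ(ct1) ≡ a_ℓ(cx1)
(mod 3)` and the octic-field isomorphism are kit certificates j279797 / j279995 of the seat, the
partner's descent element is kit j269854/j270157 of seat g4, the unit coefficients are msengine j267739 /
cc3_mstw j268223 of seat g3); the referee prices them. No Beilinson–Flach, Skinner–Urban or Yan–Zhu
input; the target's `#Ш_an = 81` is never used.

References: [GreenbergVatsal2000] Thm. (1.4) (Invent. Math. 142 (2000) §1; arXiv:math/9906215 p. 5);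
[EmertonPollackWeston2006] Thm. 1; [Kato2004Asterisque] Thm. 17.4 (3) (p. 273); [GreenbergLNM1716]
Thm. 4.1; [Wuthrich2014] Lemma 20, Prop. 21 (p. 400); [Mazur1978] Cor. 4.1; [SilvermanAEC2009]
Thm. X.4.2 (a), X.4.14; [CastellaEtAl2021] Thm. 5.1.4 (proof); cell memo D3-DOOR-CENSUS.md §2–§4.
-/

set_option autoImplicit false

noncomputable section

open scoped Classical MatrixGroups ModularForm

open CongruenceSubgroup WeierstrassCurve Literature.NumberTheory.EllipticCurves
  Literature.NumberTheory.EllipticCurves.ModularForms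
  Literature.NumberTheory.EllipticCurves.Rank1Residual
  Literature.NumberTheory.EllipticCurves.Rank1Residual.Typed
  Literature.NumberTheory.EllipticCurves.GreenbergVatsal2000
  Literature.NumberTheory.EllipticCurves.Wuthrich2014
  Literature.NumberTheory.EllipticCurves.EmertonPollackWeston2006
  Summit.BirchSwinnertonDyer.BirchSwinnertonDyer.Theorems.Rank1ResidualX1Defs

namespace Summit.BirchSwinnertonDyer.Rank1Residual

section DescentPartner

variable (W₁ W₂ : WeierstrassCurve ℚ) [W₁.IsElliptic] [W₁.IsGloballyMinimal]
  [W₂.IsElliptic] [W₂.IsGloballyMinimal]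

/-- **Mazur's main conjecture for `(E₂, 3)` by congruence transfer from a partner closed by the
`3`-DESCENT lever.** PARTNER `E₁` (`W₁` globally minimal) on row C16 at `3` (`h₁`: good ordinary,
`E₁[3]` irreducible, surj(3) ∨ ram(3)), `ord_{s=1} L(E₁,s) = 0` (`hr0₁`), exact `#Ш_an(E₁) = q₁` with
`ord₃ q₁ ≤ 2` (`hq₁`, `hv₁`), and the road-(D) CERTIFICATE `3 ∣ #Sel^(3)(E₁/ℚ)` (`hSel₁`: one non-trivial
everywhere-locally-soluble `3`-covering); certificate C2 (`hμ₁`: one `3`-adic unit coefficient of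
`ϖ₁ · L₃(f₁, α₁)`); certificate C1 (`hiso`: a `Γ_ℚ`-equivariant `E₁[3] ≃ E₂[3]`); TARGET `E₂` good
ordinary at `3` (`hord₂`). Named facts: Cassels–Tate (`hCT`), Wuthrich Prop. 21 (`hW`), modularity
(`hmodL`), GZK (`hGZK`), Kato 17.4 (3) for `E₁` (`hK₁`), Greenberg 4.1 (`hGr`), Mazur 1978 (`hM`),
Greenberg–Vatsal (1.4) (`hGV`); Wuthrich's Lemma 20 is the tree theorem
`lemma20_surjective_threeAdic_of_semistable_holds`. Proof: `BSD(E₁,3)` by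
`RowC16.bsdp_three_rankZero_of_selmer_certificate`, then `mazurMainConjecture_three_of_congruentPartner`.
[cite: GreenbergVatsal2000, Thm. (1.4) (arXiv:math/9906215 p. 5)] [cite: Kato2004Asterisque, Thm. 17.4 (3) (p. 273)]
[cite: Wuthrich2014, Prop. 21 and Lemma 20 (p. 400)] [cite: SilvermanAEC2009, Thm. X.4.14] -/
theorem mazurMainConjecture_three_of_congruentPartner_of_partner_selmer_certificate
    (hGV : thm14_mainConjecture_transfer_of_torsionIso) (hGr : greenberg_charValue_rankZero)
    (hCT : exists_casselsTate_pairing (K := ℚ)) (hW : sha_dvd_analyticSha)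
    (hGZK : rank_eq_analyticRank_of_analyticRank_le_one) (hmodL : hasEntireLFunction_rat)
    (hM : mazur_not_dvd_maninConstant_of_odd)
    (hK₁ : ∀ (κ : ZpExtension ℚ 3) (γ : Field.absoluteGaloisGroup ℚ) [NeZero (W₁.conductorNorm ℤ)]
      (f : CuspForm (Gamma0 (W₁.conductorNorm ℤ)) 2), kato_divisibility W₁ 3 (κ := κ) (γ := γ) (f := f))
    (h₁ : RowC16 W₁ 3) (hr0₁ : W₁.analyticRank = 0)
    {q₁ : ℚ} (hq₁ : shaAn W₁ = (q₁ : ℂ)) (hv₁ : padicValRat 3 q₁ ≤ 2)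
    (hSel₁ : 3 ∣ Nat.card (W₁.selmerGroup ((3 : ℕ) : ℤ)))
    (hμ₁ : ∀ [NeZero (W₁.conductorNorm ℤ)] (f₁ : CuspForm (Gamma0 (W₁.conductorNorm ℤ)) 2),
        IsNewformOf W₁ f₁ → ∀ (ϖ₁ : ℚ), (ϖ₁ : ℝ) * W₁.realPeriodRat = plusPeriod f₁ →
      ∃ n : ℕ, ‖PowerSeries.coeff n
        (PowerSeries.C (ϖ₁ : ℚ_[3]) * padicLFunction f₁ (unitRoot W₁ 3 : ℚ_[3]))‖ = 1)
    (hiso : ∃ e : geomTorsion W₁ ((3 : ℕ) : ℤ) ≃+ geomTorsion W₂ ((3 : ℕ) : ℤ),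
      ∀ (σ : Field.absoluteGaloisGroup ℚ) (P : geomTorsion W₁ ((3 : ℕ) : ℤ)), e (σ • P) = σ • e P)
    (hord₂ : GoodOrd W₂ 3) : MazurMainConjecture W₂ 3 := by
  have hbsd₁ : BSDp W₁ 3 :=
    RowC16.bsdp_three_rankZero_of_selmer_certificate W₁ hCT hW hGZK hmodL h₁ hr0₁ hq₁ hv₁ hSel₁
  obtain ⟨-, hord₁, hirr₁, hsr₁⟩ := h₁
  have hsurj₁ : Surj W₁ 3 := by
    rcases hsr₁ with hs | hram
    · exact hs
    · exact surj_of_irr_of_ram W₁ 3 hirr₁ hram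
  have hL₁ : W₁.entireLFunction 1 ≠ 0 := (W₁.analyticRank_eq_zero_iff_holds (hmodL W₁)).mp hr0₁
  exact mazurMainConjecture_three_of_congruentPartner W₁ W₂ hGV hGr hGZK
    lemma20_surjective_threeAdic_of_semistable_holds hM hK₁ hord₁ hsurj₁ hL₁ hbsd₁ hμ₁ hiso hord₂

/-- **Row C16 ∩ {r = 0} at `p = 3`: `BSD(E₂,3)` by congruence transfer from a partner closed by the
`3`-DESCENT lever** (road G with a road-D partner) — the HEADLINE, the door for `384400cx1` with partner
`384400ct1`. Hypotheses as in
`mazurMainConjecture_three_of_congruentPartner_of_partner_selmer_certificate` plus modularity with an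
integral Manin constant (`hmod`) for the rank-`0` skeleton `RowC16.bsdp_rankZero_of_mazurMainConjecture`
and the target's row / rank (`h₂`, `hr0`). NO hypothesis on `#Ш_an(E₂)`: the target's `81 = #Ш_an`
enters nowhere. Per pair (certificates: the partner's descent element `hSel₁` and exact `#Ш_an` `hq₁`,
C1 `hiso`, C2 `hμ₁`); NOT a class theorem.
[cite: GreenbergVatsal2000, Thm. (1.4) (arXiv:math/9906215 p. 5)] [cite: CastellaEtAl2021, Thm. 5.1.4 (proof)]
[cite: Wuthrich2014, Prop. 21 (p. 400)] [cite: SilvermanAEC2009, Thm. X.4.14] -/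
theorem RowC16.bsdp_three_rankZero_of_congruentPartner_of_partner_selmer_certificate
    (hGV : thm14_mainConjecture_transfer_of_torsionIso) (hGr : greenberg_charValue_rankZero)
    (hmod : nonempty_modularParametrizationData)
    (hCT : exists_casselsTate_pairing (K := ℚ)) (hW : sha_dvd_analyticSha)
    (hGZK : rank_eq_analyticRank_of_analyticRank_le_one) (hmodL : hasEntireLFunction_rat)
    (hM : mazur_not_dvd_maninConstant_of_odd)
    (hK₁ : ∀ (κ : ZpExtension ℚ 3) (γ : Field.absoluteGaloisGroup ℚ) [NeZero (W₁.conductorNorm ℤ)]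
      (f : CuspForm (Gamma0 (W₁.conductorNorm ℤ)) 2), kato_divisibility W₁ 3 (κ := κ) (γ := γ) (f := f))
    (h₁ : RowC16 W₁ 3) (hr0₁ : W₁.analyticRank = 0)
    {q₁ : ℚ} (hq₁ : shaAn W₁ = (q₁ : ℂ)) (hv₁ : padicValRat 3 q₁ ≤ 2)
    (hSel₁ : 3 ∣ Nat.card (W₁.selmerGroup ((3 : ℕ) : ℤ)))
    (hμ₁ : ∀ [NeZero (W₁.conductorNorm ℤ)] (f₁ : CuspForm (Gamma0 (W₁.conductorNorm ℤ)) 2),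
        IsNewformOf W₁ f₁ → ∀ (ϖ₁ : ℚ), (ϖ₁ : ℝ) * W₁.realPeriodRat = plusPeriod f₁ →
      ∃ n : ℕ, ‖PowerSeries.coeff n
        (PowerSeries.C (ϖ₁ : ℚ_[3]) * padicLFunction f₁ (unitRoot W₁ 3 : ℚ_[3]))‖ = 1)
    (hiso : ∃ e : geomTorsion W₁ ((3 : ℕ) : ℤ) ≃+ geomTorsion W₂ ((3 : ℕ) : ℤ),
      ∀ (σ : Field.absoluteGaloisGroup ℚ) (P : geomTorsion W₁ ((3 : ℕ) : ℤ)), e (σ • P) = σ • e P)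
    (h₂ : RowC16 W₂ 3) (hr0 : W₂.analyticRank = 0) : BSDp W₂ 3 :=
  RowC16.bsdp_rankZero_of_mazurMainConjecture hGr hmod hGZK h₂ hr0
    (mazurMainConjecture_three_of_congruentPartner_of_partner_selmer_certificate W₁ W₂ hGV hGr hCT hW
      hGZK hmodL hM hK₁ h₁ hr0₁ hq₁ hv₁ hSel₁ hμ₁ hiso h₂.2.1)

/-- **The same with the `μ`-certificate computed on a WITNESS `E₃` of the congruence class**
(Emerton–Pollack–Weston 2006 Thm. 1, `hEPW`: `μ = 0` moves inside the class along a torsion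
isomorphism `E₁[3] ≃ E₃[3]`, `hiso₁₃`; `E₃` good ordinary at `3`): e.g. `E₃ = E₂` itself with
`hiso₁₃ := hiso`, where one unit coefficient of `ϖ₂ · L₃(f₂, α₂)` is already a two-engine table value.
Proof: `BSD(E₁,3)` by the descent door, then `mazurMainConjecture_three_of_congruentPartner_of_muWitness`,
then the rank-`0` skeleton. [cite: EmertonPollackWeston2006, Thm. 1 (arXiv:math/0404484 p. 2)]
[cite: GreenbergVatsal2000, Thm. (1.4)] [cite: Wuthrich2014, Prop. 21 (p. 400)] -/
theorem RowC16.bsdp_three_rankZero_of_congruentPartner_of_partner_selmer_certificate_of_muWitness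
    (hGV : thm14_mainConjecture_transfer_of_torsionIso) (hEPW : thm1_muAn_transfer_of_torsionIso_odd)
    (hGr : greenberg_charValue_rankZero) (hmod : nonempty_modularParametrizationData)
    (hCT : exists_casselsTate_pairing (K := ℚ)) (hW : sha_dvd_analyticSha)
    (hGZK : rank_eq_analyticRank_of_analyticRank_le_one) (hmodL : hasEntireLFunction_rat)
    (hM : mazur_not_dvd_maninConstant_of_odd)
    (hK₁ : ∀ (κ : ZpExtension ℚ 3) (γ : Field.absoluteGaloisGroup ℚ) [NeZero (W₁.conductorNorm ℤ)]
      (f : CuspForm (Gamma0 (W₁.conductorNorm ℤ)) 2), kato_divisibility W₁ 3 (κ := κ) (γ := γ) (f := f))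
    (h₁ : RowC16 W₁ 3) (hr0₁ : W₁.analyticRank = 0)
    {q₁ : ℚ} (hq₁ : shaAn W₁ = (q₁ : ℂ)) (hv₁ : padicValRat 3 q₁ ≤ 2)
    (hSel₁ : 3 ∣ Nat.card (W₁.selmerGroup ((3 : ℕ) : ℤ)))
    (W₃ : WeierstrassCurve ℚ) [W₃.IsElliptic] [W₃.IsGloballyMinimal] (hord₃ : GoodOrd W₃ 3)
    (hiso₁₃ : ∃ e : geomTorsion W₁ ((3 : ℕ) : ℤ) ≃+ geomTorsion W₃ ((3 : ℕ) : ℤ),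
      ∀ (σ : Field.absoluteGaloisGroup ℚ) (P : geomTorsion W₁ ((3 : ℕ) : ℤ)), e (σ • P) = σ • e P)
    (hμ₃ : ∀ [NeZero (W₃.conductorNorm ℤ)] (f₃ : CuspForm (Gamma0 (W₃.conductorNorm ℤ)) 2),
        IsNewformOf W₃ f₃ → ∀ (ϖ₃ : ℚ), (ϖ₃ : ℝ) * W₃.realPeriodRat = plusPeriod f₃ →
      ∃ n : ℕ, ‖PowerSeries.coeff n
        (PowerSeries.C (ϖ₃ : ℚ_[3]) * padicLFunction f₃ (unitRoot W₃ 3 : ℚ_[3]))‖ = 1)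
    (hiso : ∃ e : geomTorsion W₁ ((3 : ℕ) : ℤ) ≃+ geomTorsion W₂ ((3 : ℕ) : ℤ),
      ∀ (σ : Field.absoluteGaloisGroup ℚ) (P : geomTorsion W₁ ((3 : ℕ) : ℤ)), e (σ • P) = σ • e P)
    (h₂ : RowC16 W₂ 3) (hr0 : W₂.analyticRank = 0) : BSDp W₂ 3 := by
  have hbsd₁ : BSDp W₁ 3 :=
    RowC16.bsdp_three_rankZero_of_selmer_certificate W₁ hCT hW hGZK hmodL h₁ hr0₁ hq₁ hv₁ hSel₁
  obtain ⟨-, hord₁, hirr₁, hsr₁⟩ := h₁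
  have hsurj₁ : Surj W₁ 3 := by
    rcases hsr₁ with hs | hram
    · exact hs
    · exact surj_of_irr_of_ram W₁ 3 hirr₁ hram
  have hL₁ : W₁.entireLFunction 1 ≠ 0 := (W₁.analyticRank_eq_zero_iff_holds (hmodL W₁)).mp hr0₁
  exact RowC16.bsdp_rankZero_of_mazurMainConjecture hGr hmod hGZK h₂ hr0
    (mazurMainConjecture_three_of_congruentPartner_of_muWitness W₁ W₂ hGV hEPW hGr hGZK
      lemma20_surjective_threeAdic_of_semistable_holds hM hK₁ hord₁ hsurj₁ hL₁ hbsd₁ W₃ hord₃ hiso₁₃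
      hμ₃ hiso h₂.2.1)

end DescentPartner

end Summit.BirchSwinnertonDyer.Rank1Residual

end
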